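import Summits.FinalStateConjecture.FinalStateConjecture.Theorems.StarvedNecksNeckGapDecayOfCore
import Summits.FinalStateConjecture.FinalStateConjecture.Theorems.StarvedNecksNeckGapDecayGrowingRadius
import Summits.FinalStateConjecture.FinalStateConjecture.Theorems.StarvedNecksNeckGapDecayStubSlowSmoothMinorant
import Summits.FinalStateConjecture.FinalStateConjecture.Theorems.StarvedNecksNeckGapDecayGlueTopology
import Summits.FinalStateConjecture.FinalStateConjecture.Theorems.StarvedNecksNeckGapDecayGlueSelfMap
import HarnessLib

/-!
# Self-certified ⇒ gap core certificate (crux `StarvedNecks.NeckGapDecay`, stmt-FinalStateConjecture-16768,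
# line `Sketch`; `--supports`, anchor for the open stub `stub_gapCore : OfCore.GapCoreHolds`)

The hypothesis `¬ selfCertified i` of the open physics stub `OfCore.GapCoreHolds` is COSMETIC (continuation lead c4):
if the input chart `Ψᵢ` of hole `i` is already `C²`-certified below a continuous wall `W`, then for every threshold
`T₀` a gap CORE certificate `GapCoreCert 𝓢 O d R₀ i T₀ W` holds with the input chart itself as the annular chart
(`Ψ' := Ψᵢ`, `T := id`): the receding seam `ϱ` is a slow smooth minorant (W4, `stub_slowSmoothMinorant`) of the
growing certified radius of `Ψᵢ` (`GrowingRadius.exists_growing_certified_radius`), (C1) is the late-chart structure of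
`Ψᵢ` restricted to the (open) annular tube, (C2) is trivial for `T = id`, (C3) is the given certificate restricted to
`{s ≥ ϱ + 2}`, (C4) is injectivity of `Ψᵢ` on the late region.  Consequently `GapCoreHolds` already yields a normalised
dominating wall and a core certificate for EVERY hole of an honest decomposition (`forall_gapCoreCert_of_gapCoreHolds`),
and the conjecture-level statement the planner files may drop the `¬ selfCertified` hypothesis.  Over an arbitrary
spacetime except for the last theorem, which has the MGHD quantifier prefix of `GapCoreHolds` verbatim.
References: DHRT arXiv:2104.08222, §1 (deviation norms on slabs); O'Neill 1983, Ch. 3.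
-/

noncomputable section

open scoped Manifold ContDiff Topology ENNReal
open Filter Set Topology Literature.Geometry.Lorentzian Literature.Uncategorized

namespace Summit.FinalStateConjecture.FinalStateConjecture.Theorems.NeckGapDecay.ConnectionLevelCones.OfCore

open Summit.FinalStateConjecture.FinalStateConjecture.Theorems.NeckGapDecay.ConnectionLevelCones.CertOfCoreStub
  (GapCoreCert)
open Summit.FinalStateConjecture.FinalStateConjecture.Theorems.NeckGapDecay.ConnectionLevelCones.GrowingRadius
  (exists_growing_certified_radius)
open Summit.FinalStateConjecture.FinalStateConjecture.Theorems.NeckGapDecay.ConnectionLevelCones.SlowSmoothMinorantStub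
  (stub_slowSmoothMinorant)
open Summit.FinalStateConjecture.FinalStateConjecture.Theorems.NeckGapDecay.ConnectionLevelCones.Glue
  (isOpen_image_of_isOpenEmbedding_restrict injOn_of_isOpenEmbedding_restrict
    isOpenEmbedding_restrict_of_forall_isOpen_image continuous_time continuous_spatialNorm)

-- the problem namespace `Summit.FinalStateConjecture.FinalStateConjecture` repeats the summit name by design
set_option linter.dupNamespace false
-- instance search through nested operator types `E4 →L[ℝ] E4 →L[ℝ] ℝ`
set_option maxSynthPendingDepth 3

/-- **Self-certified ⇒ gap core certificate.**  If the input chart `Ψᵢ` is `C²`-certified below the continuous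
wall `W` (the `C²` deviation from boosted Kerrᵢ on the sub-wall slabs `{tᵢ = τ, rᵢ ≤ W(x⁰)}` tends to `0`), then
`GapCoreCert 𝓢 O d R₀ i T₀ W` holds for every `T₀`, with `Ψ' := Ψᵢ`, `T := id` and a slow receding seam inside the
growing certified radius of `Ψᵢ`.  DHRT arXiv:2104.08222, §1. -/
theorem gapCoreCert_of_selfCertified (𝓢 : Spacetime.{0} 4) (O : Set 𝓢.carrier)
    (d : FinalStateDecomposition 𝓢 O 4) (R₀ : ℝ) (i : Fin d.N) (T₀ : ℝ) (W : ℝ → ℝ) (hW : Continuous W)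
    (hcert : Tendsto (fun τ ↦ supCkENorm (Subtype.val '' {x : (d.background i).domain |
        (d.background i).time x.1 = τ ∧ (d.background i).radius x.1 ≤ W (x.1 0)}) 2
        (𝓢.deviationExtend (d.background i) (d.chart i))) atTop (𝓝 0)) :
    GapCoreCert 𝓢 O d R₀ i T₀ W := by
  classical
  -- notation for hole `i`
  set Λ : lorentzGroup := (d.motion i).1 with hΛ
  set c : E4 := (d.motion i).2 with hc
  set B : ModelBackground := d.background i with hB
  set Ψ := d.chart i with hΨ
  -- the receding seam: a slow smooth minorant of the growing certified radius
  obtain ⟨Rg, hRg_mono, hRg_top, hRg_cert⟩ := exists_growing_certified_radius d i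
  obtain ⟨ϱ, hϱs, -, hϱtop, hϱb, ⟨Tϱ, hϱle⟩, hϱ1, hϱ2, hϱ3⟩ :=
    stub_slowSmoothMinorant Rg (R₀ + d.mass i + 1) hRg_mono hRg_top
  -- thresholds
  set τ₁ : ℝ := max d.τ₀ T₀ + 1 with hτ₁
  have hτ₀1 : d.τ₀ < τ₁ := by
    have := le_max_left d.τ₀ T₀
    linarith
  have hτ₀1' : d.τ₀ ≤ τ₁ - 1 := by
    have := le_max_left d.τ₀ T₀
    linarith
  refine ⟨R₀, τ₁, ϱ, Ψ, fun y ↦ y, le_rfl, ?_, ⟨hϱs, hϱ1, hϱ2, hϱ3, hϱb, hϱtop, ?_⟩, ?_, ?_, ?_, ?_⟩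
  · -- `max τ₀ T₀ ≤ τ₁`
    show max d.τ₀ T₀ ≤ max d.τ₀ T₀ + 1
    linarith
  · -- the seam lies inside the input chart's `C²`-certified zone
    have hk : ∀ R τ, 𝓢.truncDeviationCk B Ψ 2 R τ ≤ 𝓢.truncDeviationCk B Ψ 4 R τ :=
      fun R τ ↦ supCkENorm_mono_right _ (by norm_num) _
    refine tendsto_of_tendsto_of_tendsto_of_le_of_le' tendsto_const_nhds hRg_cert
      (Eventually.of_forall fun _ ↦ bot_le) ?_
    filter_upwards [eventually_ge_atTop Tϱ] with τ hτ
    exact (𝓢.truncDeviationCk_mono B Ψ 2 (hϱle τ hτ) τ).trans (hk _ _)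
  · -- (C1): the input chart restricted to the (open) annular late tube
    have hlate := d.isLateChart i
    have hc_t : Continuous fun y : E4 ↦ B.time y := continuous_time Λ c
    have hc_s : Continuous fun y : E4 ↦ E4.spatialNorm (poincareInv Λ c y) := continuous_spatialNorm Λ c
    have hc_r : Continuous fun y : E4 ↦ B.radius y :=
      (Kerr.continuous_radius (d.spin i)).comp (continuous_poincareInv Λ c)
    have hAopen : IsOpen {x : B.domain | τ₁ < B.time x.1 ∧
        ϱ (B.time x.1) + 1 < E4.spatialNorm (poincareInv (d.motion i).1 (d.motion i).2 x.1) ∧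
        B.radius x.1 < W (x.1 0) + 1} := by
      refine (isOpen_lt continuous_const (hc_t.comp continuous_subtype_val)).and
        ((isOpen_lt ?_ (hc_s.comp continuous_subtype_val)).and (isOpen_lt (hc_r.comp continuous_subtype_val) ?_))
      · exact ((hϱs.continuous.comp hc_t).add continuous_const).comp continuous_subtype_val
      · exact (hW.comp ((PiLp.continuous_apply 2 _ 0).comp continuous_subtype_val)).add continuous_const
    have hAsub : {x : B.domain | τ₁ < B.time x.1 ∧
        ϱ (B.time x.1) + 1 < E4.spatialNorm (poincareInv (d.motion i).1 (d.motion i).2 x.1) ∧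
        B.radius x.1 < W (x.1 0) + 1} ⊆ B.lateRegion d.τ₀ := fun x hx ↦ hτ₀1.trans hx.1
    refine ⟨hlate.contMDiff.contMDiffOn, ?_, ?_⟩
    · exact isOpenEmbedding_restrict_of_forall_isOpen_image hAopen hlate.contMDiff.continuous.continuousOn
        ((injOn_of_isOpenEmbedding_restrict hlate.isOpenEmbedding).mono hAsub)
        fun V hV hVA ↦ isOpen_image_of_isOpenEmbedding_restrict hlate.isOpenEmbedding hV (hVA.trans hAsub)
    · exact (image_mono hAsub).trans ((d.region_subset_charted i))
  · -- (C2): matched to itself by the identity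
    refine ⟨contDiff_id, fun x _ _ _ ↦ ⟨x.2, rfl⟩, ?_⟩
    have h0 : (fun y : E4 ↦ (fun y : E4 ↦ y) y - y) = (0 : E4 → E4) := by
      funext y
      simp
    simp_rw [h0, supCkENorm_zero]
    exact tendsto_const_nhds
  · -- (C3): the given certificate, restricted beyond the seam
    refine tendsto_of_tendsto_of_tendsto_of_le_of_le tendsto_const_nhds hcert (fun _ ↦ bot_le) fun τ ↦ ?_
    refine supCkENorm_mono (image_mono ?_) _ _
    intro x hx
    exact ⟨hx.1, hx.2.2⟩
  · -- (C4): injectivity of the input chart on the late region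
    intro x y htx hsx _ hty hsy hxy
    have hinj := injOn_of_isOpenEmbedding_restrict (d.isLateChart i).isOpenEmbedding
    have hxl : x ∈ B.lateRegion d.τ₀ := hτ₀1.trans htx
    have hyl : y ∈ B.lateRegion d.τ₀ := hτ₀1'.trans_lt hty
    have hxy' : x = y := hinj hxl hyl hxy
    subst hxy'
    linarith

/-- **The `GapCoreHolds` clause for a self-certified hole** (arbitrary spacetime): a normalised dominating wall
below which the input chart is `C²`-certified already carries a gap core certificate for the same threshold and
wall (`gapCoreCert_of_selfCertified`).  DHRT arXiv:2104.08222, §1. -/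
theorem gapCoreClause_of_selfCertified (𝓢 : Spacetime.{0} 4) (O : Set 𝓢.carrier)
    (d : FinalStateDecomposition 𝓢 O 4) (R₀ : ℝ) (i : Fin d.N)
    (hself : ∃ (T₀ : ℝ) (W : ℝ → ℝ), Continuous W ∧ Monotone W ∧ Tendsto (fun s ↦ W s / s) atTop (𝓝 0) ∧
      (∀ s s', s ≤ s' →
        W s' ≤ W s + 1 / (10 * ‖(((d.motion i).1 : E4 ≃L[ℝ] E4) : E4 →L[ℝ] E4)‖ ^ 2) * (s' - s)) ∧
      (∀ s, R₀ + 2 ≤ W s) ∧ (∀ s, T₀ ≤ s → 3 * d.excision i s + 2 ≤ W s) ∧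
      Tendsto (fun τ ↦ supCkENorm (Subtype.val '' {x : (d.background i).domain |
        (d.background i).time x.1 = τ ∧ (d.background i).radius x.1 ≤ W (x.1 0)}) 2
        (𝓢.deviationExtend (d.background i) (d.chart i))) atTop (𝓝 0)) :
    ∃ (T₀ : ℝ) (W : ℝ → ℝ), Continuous W ∧ Monotone W ∧ Tendsto (fun s ↦ W s / s) atTop (𝓝 0) ∧
      (∀ s s', s ≤ s' →
        W s' ≤ W s + 1 / (10 * ‖(((d.motion i).1 : E4 ≃L[ℝ] E4) : E4 →L[ℝ] E4)‖ ^ 2) * (s' - s)) ∧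
      (∀ s, R₀ + 2 ≤ W s) ∧ (∀ s, T₀ ≤ s → 3 * d.excision i s + 2 ≤ W s) ∧
      GapCoreCert 𝓢 O d R₀ i T₀ W := by
  obtain ⟨T₀, W, hWc, hWm, hWs, hWl, hW2, hWd, hcert⟩ := hself
  exact ⟨T₀, W, hWc, hWm, hWs, hWl, hW2, hWd, gapCoreCert_of_selfCertified 𝓢 O d R₀ i T₀ W hWc hcert⟩

/-- **`GapCoreHolds` certifies EVERY hole.**  Under `OfCore.GapCoreHolds`, every hole `i` of an honest `C⁴`
decomposition of the exterior of a maximal vacuum development of admissible data — self-certified or not — admits a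
threshold, a normalised dominating wall and a gap core certificate: the `¬ selfCertified` hypothesis of the open stub
is cosmetic (`gapCoreClause_of_selfCertified` in the self-certified case).  The hypothesis-free form of the
conjecture-level statement behind `NeckGapDecay`.  DHRT arXiv:2104.08222, §1. -/
theorem forall_gapCoreCert_of_gapCoreHolds (h : GapCoreHolds) :
    ∀ (X : Type) [TopologicalSpace X] [ChartedSpace E3 X] [IsManifold (𝓡 3) ∞ X] [ConnectedSpace X]
    (D : InitialDataSet (𝓡 3) X), D ∈ admissibleVacuumData X →
    ∀ 𝒟 : VacuumCauchyDevelopment D, 𝒟.IsMaximal →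
    ∀ (O : Set 𝒟.carrier) (d : FinalStateDecomposition 𝒟.toSpacetime O 4) (R₀ : ℝ),
      O = exteriorOf 𝒟.toCauchyDevelopment d.charted →
      HonestCore 𝒟.toSpacetime O 4 d R₀ → HonestFar 𝒟.toSpacetime O 4 d R₀ → DistinctVelocities d →
      ∀ i : Fin d.N,
      ∃ (T₀ : ℝ) (W : ℝ → ℝ), Continuous W ∧ Monotone W ∧ Tendsto (fun s ↦ W s / s) atTop (𝓝 0) ∧
        (∀ s s', s ≤ s' → W s' ≤ W s + 1 / (10 * ‖(((d.motion i).1 : E4 ≃L[ℝ] E4) : E4 →L[ℝ] E4)‖ ^ 2) * (s' - s)) ∧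
        (∀ s, R₀ + 2 ≤ W s) ∧ (∀ s, T₀ ≤ s → 3 * d.excision i s + 2 ≤ W s) ∧
        GapCoreCert 𝒟.toSpacetime O d R₀ i T₀ W := by
  intro X _ _ _ _ D hD 𝒟 h𝒟 O d R₀ hO hHc hHf hDV i
  by_cases hself : ∃ (T₀ : ℝ) (W : ℝ → ℝ), Continuous W ∧ Monotone W ∧ Tendsto (fun s ↦ W s / s) atTop (𝓝 0) ∧
      (∀ s s', s ≤ s' →
        W s' ≤ W s + 1 / (10 * ‖(((d.motion i).1 : E4 ≃L[ℝ] E4) : E4 →L[ℝ] E4)‖ ^ 2) * (s' - s)) ∧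
      (∀ s, R₀ + 2 ≤ W s) ∧ (∀ s, T₀ ≤ s → 3 * d.excision i s + 2 ≤ W s) ∧
      Tendsto (fun τ ↦ supCkENorm (Subtype.val '' {x : (d.background i).domain |
        (d.background i).time x.1 = τ ∧ (d.background i).radius x.1 ≤ W (x.1 0)}) 2
        (𝒟.toSpacetime.deviationExtend (d.background i) (d.chart i))) atTop (𝓝 0)
  · exact gapCoreClause_of_selfCertified 𝒟.toSpacetime O d R₀ i hself
  · exact h X D hD 𝒟 h𝒟 O d R₀ hO hHc hHf hDV i hself

end Summit.FinalStateConjecture.FinalStateConjecture.Theorems.NeckGapDecay.ConnectionLevelCones.OfCore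

end
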